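import Literature.Computability.Complexity.PRGDerandomization
import Literature.Computability.Complexity.ExpPadding
import Literature.Computability.Complexity.MapFstMachine
import Literature.Computability.Complexity.SplitOnesBricks
import Literature.Computability.Complexity.IsqrtBrick
import Literature.Computability.Complexity.FPStringBricks
import Literature.Computability.Complexity.IKWScales
import HarnessLib

/-!
# The infinitely-often simulation of `BPP` by a polynomial-stretch generator, in time `2^{n^ε}`
# (Impagliazzo–Wigderson 1998 / Trevisan–Vadhan 2007, Lemma 2.3: the machine)

Literature / complexity — the MACHINE half of the "uniform PRG ⟹ i.o. pseudo-time simulation"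
step in the proof of the uniform hardness-versus-randomness theorem
(`UniformDerandomization.lean`, named fact `impagliazzoWigderson1998_samplable` = van Melkebeek
2000, Thm. 6.2.1 = Impagliazzo–Wigderson 1998, Thm. 5 (BPP half); Trevisan–Vadhan 2007,
Lemma 2.3: "Consider the deterministic algorithm `A` that, on any input `x` of length `n`,
computes `A(x) = maj_{s ∈ {0,1}^{ℓ(n)}} M(x; G(s))` … `A` runs in time `2^{ℓ} · poly`").

Given a witness language `L₁ ∈ P` with coin polynomial `q₁` (the error-reduced `BPP` machine
`M(x; r) = [⟨x, r⟩ ∈ L₁]`) and a generator family read off a string function `F ∈ FP` ON PADDED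
INPUTS — `F (1^{2^{ℓ^{c₀}}} 0 ⟨1^ℓ, σ⟩) = G ℓ σ` for seeds `σ ∈ {0,1}^{ℓ^{c₀}}` (i.e. `G ℓ` is
computable in time `2^{ℓ^{c₀}} · poly`, expressed by polynomial time on the exponential pad as in
Arora–Barak 2009, §2.6.2) — this file builds the language

  `simLang = {x | 2^{s} < 2 · #{i < 2^s | ⟨x, G ℓ (bits_s i) ↾ q₁(n)⟩ ∈ L₁}}`,
  `n = |x|`, `ℓ = ⌊√⌋^{J}(n)` (the `J`-fold integer square root), `s = ℓ^{c₀}`,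

(the majority vote of `M(x; ·)` over all outputs of `G ℓ`) and proves
**`simLang ∈ DTIME (fun n => 2 ^ ⌈(n : ℝ) ^ ε⌉₊)` whenever `c₀ < ε · 2^J`**
(`UDerand.simLang_mem_DTIME`, hypothesis in the form `c₀ · 2^{-J} < ε`). The index
`ℓ = ⌊√⌋^{J}(n) = Nat.sqrt^[J] n` — the scale of `IKWScales.lean`, whose arithmetic
(`iterate_sqrt_pow_self`: SURJECTIVE with right inverse `n = ℓ^{2^J}`; `tendsto_iterate_sqrt`;
`eventually_cost_pow_le_two_pow_ceil_rpow`, `exists_const_of_eventually_le`, `exists_root_depth`) is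
reused here — keeps everything in integer arithmetic; surjectivity is what carries "for almost all
`n`" over to "for almost all `ℓ`" in the security argument (`UniformDerandomizationProofs.lean`).

## The machine (three stages, per-input additive time, `Turing.TM2ComputableAux.comp_outputsWithin`)

1. `UDerand.preF` (`FP`): `x ↦ ⟨1^s, x⟩` (iterated integer square root of the length in unary by
   `Brick.isqrtFn` + `Brick.binToUnaryFn`, then the unary value of `X^{c₀}`, `Plumb.polyFn`);
2. the exponential pad `expPad 1` (`ExpPadding.lean`, time `C · 2^{s} + C`) on the first component
   (`mapFstAux`, `MapFstMachine.lean`): `⟨1^s, x⟩ ↦ ⟨1^{2^s} 0 1^s, x⟩`;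
3. `UDerand.verdictF` (`FP` in the padded length, brick algebra on the model of
   `PRGDerand.verdictF`): the counted fold (`Brick.foldLoop addFn`) over `i < 2^s ≤ |pad|` of the
   one-symbol pieces `[⟨x, F(1^{2^s} 0 ⟨1^ℓ, bits_s i⟩) ↾ q₁(n)⟩ ∈ L₁]`, then `[2^s < 2 · count]`.

The running time is a polynomial in `2^s + n`, and `s = ⌊√⌋^{J}(n)^{c₀} ≤ n^{c₀ / 2^J}`, so it is
`≤ c' · 2^{⌈n^ε⌉₊} + c'` for all `n` once `c₀ · 2^{-J} < ε` (`UDerand.exists_time_bound`, from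
`IKWScales.eventually_cost_pow_le_two_pow_ceil_rpow` and `exists_const_of_eventually_le`).

## References

* R. Impagliazzo, A. Wigderson, *Randomness vs time: derandomization under a uniform assumption*,
  JCSS 63 (2001) 672–688 (FOCS 1998), Thm. 5 [ImpagliazzoWigderson2001].
* L. Trevisan, S. Vadhan, *Pseudorandomness and average-case complexity via uniform reductions*,
  Comput. Complexity 16 (2007) 331–364, Lemma 2.3 and its proof [TrevisanVadhan2007].
* D. van Melkebeek, *Randomness and Completeness in Computational Complexity*, LNCS 1950 (2000),
  Thm. 6.2.1 [VanMelkebeek2000].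
* S. Arora, B. Barak, *Computational Complexity: A Modern Approach*, CUP 2009, Lemma 20.3 (proof:
  "go over all `z ∈ {0,1}^{ℓ(n)}`, compute `A(x, G(z))` and output the majority answer"), §2.6.2
  (padding), §1.3 (composition) [AroraBarakCC2009].
-/

noncomputable section

namespace Literature.Computability.Complexity

open _root_.Computability Finset Filter Polynomial Brick Plumb

namespace UDerand

/-! ### The index in unary, in `FP` -/

/-- `rootFn w = 1^{⌊√|w|⌋}` (the numeral `isqrtFn w` converted back to unary along the ruler `w`).
[folklore] -/
def rootFn : List Bool → List Bool := binToUnaryFn ∘ fanoutFn (fun w => w) isqrtFn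

/-- Value of `rootFn`. [folklore] -/
@[simp] theorem rootFn_apply (w : List Bool) : rootFn w = ones (Nat.sqrt w.length) := by
  simp [rootFn, min_eq_left (Nat.sqrt_le_self _)]

/-- `rootFn ∈ FP`. [folklore] -/
theorem rootFn_mem_FP : rootFn ∈ FP :=
  comp_mem_FP binToUnaryFn_mem_FP (fanoutFn_mem_FP (PolyTimeComputable.id _) isqrtFn_mem_FP)

/-- `rootIterFn J w = 1^{Nat.sqrt^[J] |w|}` (the scale of `IKWScales.lean` in unary). [folklore] -/
def rootIterFn : ℕ → List Bool → List Bool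
  | 0 => onesFn
  | J + 1 => rootFn ∘ rootIterFn J

/-- Value of `rootIterFn`. [folklore] -/
@[simp] theorem rootIterFn_apply (J : ℕ) (w : List Bool) : rootIterFn J w = ones (Nat.sqrt^[J] w.length) := by
  induction J with
  | zero => simp [rootIterFn, onesFn, ones, OracleCompose.unaryEncodeNat_eq_replicate]
  | succ J ih => simp [rootIterFn, ih, Function.iterate_succ_apply', ones]

/-- `rootIterFn J ∈ FP`. [folklore] -/
theorem rootIterFn_mem_FP : ∀ J : ℕ, rootIterFn J ∈ FP
  | 0 => onesFn_mem_FP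
  | J + 1 => comp_mem_FP rootFn_mem_FP (rootIterFn_mem_FP J)


/-! ### The parameters of the simulation -/

section Params

variable (c₀ J : ℕ)

/-- The index of input length `n`: `ℓ = ⌊√⌋^{J}(n) = Nat.sqrt^[J] n`. [folklore] -/
def ellOf (n : ℕ) : ℕ := Nat.sqrt^[J] n

/-- **Right inverse**: `ellOf J (ℓ^{2^J}) = ℓ` (`iterate_sqrt_pow_self`; the reindexing is surjective).
[folklore] -/
theorem ellOf_pow (ℓ : ℕ) : ellOf J (ℓ ^ 2 ^ J) = ℓ := iterate_sqrt_pow_self J ℓ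

/-- The seed length at input length `n`: `s = ℓ^{c₀}`. [folklore] -/
def sOf (n : ℕ) : ℕ := ellOf J n ^ c₀

end Params

/-! ### Stage 3: the majority vote on the padded input, in the brick algebra -/

section Machine

variable (L₁ : Language Bool) (q₁ : Polynomial ℕ) (F : List Bool → List Bool) (c₀ J : ℕ)

/-- On the padded input `P = ⟨1^{2^s} 0 1^s, x⟩`: the index `1^ℓ` (recomputed from `x`). [folklore] -/
def ellF : List Bool → List Bool := rootIterFn J ∘ sndF

/-- On `P`: the seed length `1^s`, `s = ℓ^{c₀}`. [folklore] -/
def sF : List Bool → List Bool := polyFn (X ^ c₀) ∘ ellF J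

/-- On `P`: the pad `1^{2^s}` (the leading block of ones of the first component). [folklore] -/
def padOnesF : List Bool → List Bool := onesPrefixFn ∘ fstF

/-- On a round argument `⟨P, 1ⁱ⟩`: the `i`-th seed `bits_s i = takeD s (bin i)`. [folklore] -/
def seedF : List Bool → List Bool := fstF ∘ padTakeFn ∘ fanoutFn (sF c₀ J ∘ fstF) (lenBinF ∘ sndF)

/-- On `⟨P, 1ⁱ⟩`: the generator's padded input `1^{2^s} 0 ⟨1^ℓ, bits_s i⟩`. [folklore] -/
def genInF : List Bool → List Bool :=
  fun z => (padOnesF ∘ fstF) z ++ (List.cons false ∘ fanoutFn (ellF J ∘ fstF) (seedF c₀ J)) z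

/-- On `⟨P, 1ⁱ⟩`: the coins handed to the `BPP` predicate, `F(…) ↾ q₁(n)` (padded). [folklore] -/
def coinsF : List Bool → List Bool :=
  fstF ∘ padTakeFn ∘ fanoutFn (polyFn q₁ ∘ sndF ∘ fstF) (F ∘ genInF c₀ J)

/-- **The piece of round `i`**: `[⟨x, G ℓ (bits_s i) ↾ q₁(n)⟩ ∈ L₁]`, one symbol.
[cite: TrevisanVadhan2007, Lemma 2.3 (proof)] -/
def pieceF : List Bool → List Bool :=
  (fun w => encodeBool (L₁.boolIndicator w)) ∘ fanoutFn (sndF ∘ fstF) (coinsF q₁ F c₀ J)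

/-- On `P`: the number of seeds `bin 2^s = 0^s 1`. [folklore] -/
def cntNumF : List Bool → List Bool := (fun w => Kannan.zerosFn w ++ [true]) ∘ sF c₀ J

/-- The fold's initial record `P ↦ ⟨P, ⟨bin 2^s, ⟨1⁰, bin 0⟩⟩⟩`. [folklore] -/
def initF : List Bool → List Bool :=
  fanoutFn (fun w => w) (fanoutFn (cntNumF c₀ J) fun _ => boolPair [] [])

/-- **The number of accepting seeds**, a canonical numeral: the counted fold over `i < 2^s` (at
most `|P|` rounds). [cite: AroraBarakCC2009, Lemma 20.3 (proof)] -/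
def accF : List Bool → List Bool :=
  sndPow 2 ∘ foldLoop addFn (clipF 1 (pieceF L₁ q₁ F c₀ J)) X ∘ initF c₀ J

/-- **The verdict** `[2^s < 2 · #accepting seeds]`.
[cite: TrevisanVadhan2007, Lemma 2.3 (proof: "`A(x) = maj_s M(x; G(s))`")] -/
def verdictF : List Bool → List Bool :=
  ltFn ∘ fanoutFn (cntNumF c₀ J) (addFn ∘ fanoutFn (accF L₁ q₁ F c₀ J) (accF L₁ q₁ F c₀ J))

/-! #### Membership in `FP` -/

variable {L₁ F}

/-- `ellF ∈ FP`. [folklore] -/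
theorem ellF_mem_FP : ellF J ∈ FP := comp_mem_FP (rootIterFn_mem_FP J) sndF_mem_FP

/-- `sF ∈ FP`. [folklore] -/
theorem sF_mem_FP : sF c₀ J ∈ FP := comp_mem_FP (polyFn_mem_FP _) (ellF_mem_FP J)

/-- `padOnesF ∈ FP`. [folklore] -/
theorem padOnesF_mem_FP : padOnesF ∈ FP := comp_mem_FP onesPrefixFn_mem_FP fstF_mem_FP

/-- `seedF ∈ FP`. [folklore] -/
theorem seedF_mem_FP : seedF c₀ J ∈ FP :=
  comp_mem_FP fstF_mem_FP (comp_mem_FP padTakeFn_mem_FP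
    (fanoutFn_mem_FP (comp_mem_FP (sF_mem_FP c₀ J) fstF_mem_FP) (comp_mem_FP lenBinF_mem_FP sndF_mem_FP)))

/-- `genInF ∈ FP`. [folklore] -/
theorem genInF_mem_FP : genInF c₀ J ∈ FP :=
  append_mem_FP (comp_mem_FP padOnesF_mem_FP fstF_mem_FP)
    (comp_mem_FP (cons_mem_FP false) (fanoutFn_mem_FP (comp_mem_FP (ellF_mem_FP J) fstF_mem_FP) (seedF_mem_FP c₀ J)))

/-- `coinsF ∈ FP` for `F ∈ FP`. [folklore] -/
theorem coinsF_mem_FP (hF : F ∈ FP) : coinsF q₁ F c₀ J ∈ FP :=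
  comp_mem_FP fstF_mem_FP (comp_mem_FP padTakeFn_mem_FP
    (fanoutFn_mem_FP (comp_mem_FP (polyFn_mem_FP q₁) (comp_mem_FP sndF_mem_FP fstF_mem_FP))
      (comp_mem_FP hF (genInF_mem_FP c₀ J))))

/-- `pieceF ∈ FP` for `L₁ ∈ P`, `F ∈ FP`. [cite: AroraBarakCC2009, §1.3 (composition)] -/
theorem pieceF_mem_FP (hL₁ : L₁ ∈ Classes.P) (hF : F ∈ FP) : pieceF L₁ q₁ F c₀ J ∈ FP :=
  comp_mem_FP (indicatorFn_mem_FP hL₁)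
    (fanoutFn_mem_FP (comp_mem_FP sndF_mem_FP fstF_mem_FP) (coinsF_mem_FP q₁ c₀ J hF))

/-- `cntNumF ∈ FP`. [folklore] -/
theorem cntNumF_mem_FP : cntNumF c₀ J ∈ FP :=
  comp_mem_FP (append_mem_FP Kannan.zerosFn_mem_FP (const_mem_FP [true])) (sF_mem_FP c₀ J)

/-- `initF ∈ FP`. [folklore] -/
theorem initF_mem_FP : initF c₀ J ∈ FP :=
  fanoutFn_mem_FP (PolyTimeComputable.id _) (fanoutFn_mem_FP (cntNumF_mem_FP c₀ J) (const_mem_FP _))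

/-- **`accF ∈ FP`** for `L₁ ∈ P`, `F ∈ FP`. [cite: AroraBarakCC2009, §1.3 (bounded loops)] -/
theorem accF_mem_FP (hL₁ : L₁ ∈ Classes.P) (hF : F ∈ FP) : accF L₁ q₁ F c₀ J ∈ FP :=
  comp_mem_FP (sndPow_mem_FP 2)
    (comp_mem_FP (foldLoop_clipF_mem_FP 1 addFn_mem_FP length_addFn_le (pieceF_mem_FP q₁ c₀ J hL₁ hF) _)
      (initF_mem_FP c₀ J))

/-- **`verdictF ∈ FP`** for `L₁ ∈ P`, `F ∈ FP`. [cite: AroraBarakCC2009, Lemma 20.3 (proof)] -/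
theorem verdictF_mem_FP (hL₁ : L₁ ∈ Classes.P) (hF : F ∈ FP) : verdictF L₁ q₁ F c₀ J ∈ FP :=
  comp_mem_FP ltFn_mem_FP (fanoutFn_mem_FP (cntNumF_mem_FP c₀ J)
    (comp_mem_FP addFn_mem_FP (fanoutFn_mem_FP (accF_mem_FP q₁ c₀ J hL₁ hF) (accF_mem_FP q₁ c₀ J hL₁ hF))))

/-! #### Values on the padded input `⟨expPad 1 (1^s), x⟩` -/

variable (L₁ F)

/-- The padded input of stage 3: `padIn x = ⟨1^{2^s} 0 1^s, x⟩`, `s = sOf c₀ J |x|`. [folklore] -/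
def padIn (x : List Bool) : List Bool := boolPair (expPad 1 (ones (sOf c₀ J x.length))) x

/-- `expPad 1 (1^s) = 1^{2^s} 0 1^s`. [folklore] -/
theorem expPad_one_ones (s : ℕ) : expPad 1 (ones s) = ones (2 ^ s) ++ false :: ones s := by
  simp [expPad, ones]

/-- Value of `ellF` on the padded input. [folklore] -/
theorem ellF_padIn (x : List Bool) : ellF J (padIn c₀ J x) = ones (ellOf J x.length) := by
  simp [ellF, padIn, ellOf]

/-- Value of `sF` on the padded input. [folklore] -/
theorem sF_padIn (x : List Bool) : sF c₀ J (padIn c₀ J x) = ones (sOf c₀ J x.length) := by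
  simp [sF, ellF_padIn, sOf, ones]

/-- Value of `padOnesF` on the padded input: the pad `1^{2^s}`. [folklore] -/
theorem padOnesF_padIn (x : List Bool) : padOnesF (padIn c₀ J x) = ones (2 ^ sOf c₀ J x.length) := by
  simp only [padOnesF, padIn, Function.comp_apply, fstF_boolPair, expPad_one_ones, onesPrefixFn_ones_append]

/-- Value of `seedF` on a round argument. [folklore] -/
theorem seedF_apply (x : List Bool) (i : ℕ) :
    seedF c₀ J (boolPair (padIn c₀ J x) (ones i)) = List.takeD (sOf c₀ J x.length) (encodeNat i) false := by
  simp [seedF, sF_padIn, ones]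

/-- Value of `genInF` on a round argument: the generator's padded input for the `i`-th seed. [folklore] -/
theorem genInF_apply (x : List Bool) (i : ℕ) :
    genInF c₀ J (boolPair (padIn c₀ J x) (ones i)) =
      ones (2 ^ sOf c₀ J x.length) ++ false ::
        boolPair (ones (ellOf J x.length)) (List.takeD (sOf c₀ J x.length) (encodeNat i) false) := by
  simp only [genInF, Function.comp_apply, fstF_boolPair, padOnesF_padIn, fanoutFn_apply, ellF_padIn, seedF_apply]

/-- Value of `coinsF` on a round argument. [folklore] -/
theorem coinsF_apply (x : List Bool) (i : ℕ) :
    coinsF q₁ F c₀ J (boolPair (padIn c₀ J x) (ones i)) = List.takeD (q₁.eval x.length)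
      (F (ones (2 ^ sOf c₀ J x.length) ++ false ::
        boolPair (ones (ellOf J x.length)) (List.takeD (sOf c₀ J x.length) (encodeNat i) false))) false := by
  simp only [coinsF, Function.comp_apply, fanoutFn_apply, fstF_boolPair, genInF_apply, padTakeFn_boolPair]
  simp [padIn, ones]

/-- **Value of the piece of round `i`.** [folklore] -/
theorem pieceF_apply (x : List Bool) (i : ℕ) :
    pieceF L₁ q₁ F c₀ J (boolPair (padIn c₀ J x) (ones i)) = [L₁.boolIndicator (boolPair x (List.takeD (q₁.eval x.length)
      (F (ones (2 ^ sOf c₀ J x.length) ++ false ::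
        boolPair (ones (ellOf J x.length)) (List.takeD (sOf c₀ J x.length) (encodeNat i) false))) false))] := by
  simp only [pieceF, Function.comp_apply, fanoutFn_apply, fstF_boolPair, coinsF_apply, encodeBool]
  simp [padIn]

/-- The piece is one symbol long on every input. [folklore] -/
theorem length_pieceF (w : List Bool) : (pieceF L₁ q₁ F c₀ J w).length = 1 := by
  simp [pieceF, encodeBool]

/-- Value of `cntNumF`: the numeral of `2^s`. [folklore] -/
theorem cntNumF_padIn (x : List Bool) : cntNumF c₀ J (padIn c₀ J x) = encodeNat (2 ^ sOf c₀ J x.length) := by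
  simp [cntNumF, sF_padIn, ones, Com.encodeNat_two_pow]

/-- Value of `initF`. [folklore] -/
theorem initF_padIn (x : List Bool) : initF c₀ J (padIn c₀ J x) =
    boolPair (padIn c₀ J x) (boolPair (encodeNat (2 ^ sOf c₀ J x.length)) (boolPair (ones 0) (encodeNat 0))) := by
  simp [initF, cntNumF_padIn, ones]
  rfl

/-- **The count of accepting seeds** on input `x` (for the raw string function `F`): the number of
`i < 2^s` whose seed `bits_s i` leads the `BPP` predicate to accept.
[cite: TrevisanVadhan2007, Lemma 2.3 (proof)] -/
def accCount (x : List Bool) : ℕ :=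
  ∑ i ∈ range (2 ^ sOf c₀ J x.length), (L₁.boolIndicator (boolPair x (List.takeD (q₁.eval x.length)
    (F (ones (2 ^ sOf c₀ J x.length) ++ false ::
      boolPair (ones (ellOf J x.length)) (List.takeD (sOf c₀ J x.length) (encodeNat i) false))) false))).toNat

/-- The pad is long enough for the loop: `2^s ≤ |padIn x|`. [folklore] -/
theorem two_pow_sOf_le_length_padIn (x : List Bool) : 2 ^ sOf c₀ J x.length ≤ (padIn c₀ J x).length := by
  rw [padIn, length_boolPair, length_expPad, pow_one]
  simp only [ones, List.length_replicate]
  omega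

/-- **Value of `accF`** on the padded input: the numeral of `accCount x`. [folklore] -/
theorem accF_padIn (x : List Bool) : accF L₁ q₁ F c₀ J (padIn c₀ J x) = encodeNat (accCount L₁ q₁ F c₀ J x) := by
  have hk : 2 ^ sOf c₀ J x.length ≤ (X : Polynomial ℕ).eval (padIn c₀ J x).length := by
    rw [eval_X]; exact two_pow_sOf_le_length_padIn c₀ J x
  simp only [accF, Function.comp_apply, initF_padIn]
  rw [foldLoop_apply addFn _ hk 0 (encodeNat 0), sndPow_succ_boolPair, sndPow_succ_boolPair,
    sndPow_zero_boolPair, foldAcc_clipF (fun j _ _ => by rw [length_pieceF]; omega), foldAcc_addFn]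
  have hb : ∀ b : Bool, bitsToNat [b] = b.toNat := fun b => by rw [bitsToNat_cons]; simp
  simp only [zero_add, accCount, pieceF_apply, hb]

/-- **Value of the verdict** on the padded input: `[2^s < 2 · accCount x]`. [folklore] -/
theorem verdictF_padIn (x : List Bool) : verdictF L₁ q₁ F c₀ J (padIn c₀ J x) =
    [decide (2 ^ sOf c₀ J x.length < 2 * accCount L₁ q₁ F c₀ J x)] := by
  simp [verdictF, cntNumF_padIn, accF_padIn, two_mul]

end Machine


/-! ### Stage 1: the seed length in unary -/

section Stage1

variable (c₀ J : ℕ)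

/-- **Stage 1**: `preF x = ⟨1^s, x⟩`, `s = sOf c₀ J |x|`. [folklore] -/
def preF : List Bool → List Bool := fanoutFn (polyFn (X ^ c₀) ∘ rootIterFn J) fun w => w

/-- Value of `preF`. [folklore] -/
theorem preF_apply (x : List Bool) : preF c₀ J x = boolPair (ones (sOf c₀ J x.length)) x := by
  simp [preF, sOf, ellOf, ones]

/-- `preF ∈ FP`. [folklore] -/
theorem preF_mem_FP : preF c₀ J ∈ FP :=
  fanoutFn_mem_FP (comp_mem_FP (polyFn_mem_FP _) (rootIterFn_mem_FP J)) (PolyTimeComputable.id _)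

end Stage1

/-! ### The time bound: `poly(2^s + n) ≤ c' · 2^{⌈n^ε⌉₊} + c'` once `c₀ · 2^{-J} < ε` -/

section TimeBound

/-- **The time bound.** If `c₀ · 2^{-J} < ε`, then for all `a, j` there is `c'` with
`a (2^{sOf n} + n + 2)^j + a ≤ c' · 2^{⌈n^ε⌉₊} + c'` for EVERY `n`: the cost lemma of `IKWScales.lean`
(`eventually_cost_pow_le_two_pow_ceil_rpow` with `A = 1`, `p = c₀`, coefficient `a 3^j + j`, using
`2^s + n + 2 ≤ 3 (2^s + n)`), and the finitely many small `n` absorbed in the constant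
(`exists_const_of_eventually_le`). [cite: AroraBarakCC2009, §2.6.2 (padding arithmetic)] -/
theorem exists_time_bound (c₀ J a j : ℕ) {ε : ℝ} (hε : (c₀ : ℝ) * (1 / 2 : ℝ) ^ J < ε) :
    ∃ c' : ℕ, ∀ n : ℕ, a * (2 ^ sOf c₀ J n + n + 2) ^ j + a ≤ c' * 2 ^ ⌈(n : ℝ) ^ ε⌉₊ + c' := by
  refine exists_const_of_eventually_le ?_
  filter_upwards [eventually_cost_pow_le_two_pow_ceil_rpow (a * 3 ^ j + j) 1 c₀ J hε] with n hn
  refine le_trans ?_ hn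
  rw [one_mul, show (Nat.sqrt^[J] n) ^ c₀ = sOf c₀ J n from rfl]
  set s := sOf c₀ J n
  have h2s : 1 ≤ 2 ^ s := Nat.one_le_two_pow
  have hZ1 : 1 ≤ 2 ^ s + n := le_add_right h2s
  have h3 : 2 ^ s + n + 2 ≤ 3 * (2 ^ s + n) := by omega
  have hpow : (2 ^ s + n + 2) ^ j ≤ 3 ^ j * (2 ^ s + n) ^ (a * 3 ^ j + j) :=
    calc (2 ^ s + n + 2) ^ j ≤ (3 * (2 ^ s + n)) ^ j := Nat.pow_le_pow_left h3 j
      _ = 3 ^ j * (2 ^ s + n) ^ j := mul_pow _ _ _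
      _ ≤ 3 ^ j * (2 ^ s + n) ^ (a * 3 ^ j + j) := Nat.mul_le_mul_left _ (Nat.pow_le_pow_right hZ1 (by omega))
  have ha : a ≤ a * 3 ^ j + j := (Nat.le_mul_of_pos_right a (Nat.one_le_pow _ _ (by norm_num))).trans (Nat.le_add_right _ _)
  calc a * (2 ^ s + n + 2) ^ j + a ≤ a * (3 ^ j * (2 ^ s + n) ^ (a * 3 ^ j + j)) + a :=
        Nat.add_le_add_right (Nat.mul_le_mul_left a hpow) a
    _ = (a * 3 ^ j) * (2 ^ s + n) ^ (a * 3 ^ j + j) + a := by ring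
    _ ≤ (a * 3 ^ j + j) * (2 ^ s + n) ^ (a * 3 ^ j + j) + (a * 3 ^ j + j) :=
        Nat.add_le_add (Nat.mul_le_mul_right _ (Nat.le_add_right _ _)) ha

end TimeBound

/-! ### The composite machine and the simulated language -/

section Sim

variable (L₁ : Language Bool) (q₁ : Polynomial ℕ) (F : List Bool → List Bool) (c₀ J : ℕ)

/-- **The simulated language** `simLang = {x | 2^s < 2 · accCount x}`: the majority vote of the
`BPP` predicate `[⟨x, ·⟩ ∈ L₁]` over the `2^s` outputs `F(1^{2^s} 0 ⟨1^ℓ, bits_s i⟩) ↾ q₁(|x|)` of the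
generator at index `ℓ = ⌊√⌋^{J}(|x|)`, `s = ℓ^{c₀}`.
[cite: TrevisanVadhan2007, Lemma 2.3 (proof: the algorithm `A`)] [cite: VanMelkebeek2000, Thm. 6.2.1 (the language `B`)] -/
def simLang : Language Bool := {x | 2 ^ sOf c₀ J x.length < 2 * accCount L₁ q₁ F c₀ J x}

variable {L₁ F}

/-- The verdict of stage 3 on the padded input is the indicator of `simLang`. [folklore] -/
theorem verdictF_padIn_eq_encodeBool (x : List Bool) :
    verdictF L₁ q₁ F c₀ J (padIn c₀ J x) = encodeBool ((simLang L₁ q₁ F c₀ J).boolIndicator x) := by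
  rw [verdictF_padIn]
  by_cases hx : x ∈ simLang L₁ q₁ F c₀ J
  · rw [(Set.mem_iff_boolIndicator _ _).1 hx, encodeBool]
    have hx' : 2 ^ sOf c₀ J x.length < 2 * accCount L₁ q₁ F c₀ J x := hx
    simp [hx']
  · rw [(Set.notMem_iff_boolIndicator _ _).1 hx, encodeBool]
    have hx' : ¬ 2 ^ sOf c₀ J x.length < 2 * accCount L₁ q₁ F c₀ J x := hx
    simp [hx']

/-- A polynomial below a power: `p(m) ≤ c (m^k + 1)` with `exists_eval_le_mul_pow_add`, and powers of
`m ≤ b Z` against `Z^k`. [folklore] -/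
theorem eval_le_of_le_mul {p : Polynomial ℕ} {c k : ℕ} (hp : ∀ m, p.eval m ≤ c * m ^ k + c)
    {b Z m : ℕ} (hm : m ≤ b * Z) : p.eval m ≤ c * b ^ k * Z ^ k + c := by
  have := hp m
  have h2 : m ^ k ≤ (b * Z) ^ k := Nat.pow_le_pow_left hm k
  rw [mul_pow] at h2
  nlinarith

/-- **The composite machine** (stage 1 `preF`, stage 2 the exponential pad on the first component,
stage 3 `verdictF`; per-input additive time): for `L₁ ∈ P` and `F ∈ FP` some TM2 machine outputs
`[x ∈ simLang]` on every input `x` within `a (2^s + |x| + 2)^j + a` steps, `s = sOf c₀ J |x|`.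
[cite: TrevisanVadhan2007, Lemma 2.3 (proof: "`A` runs in time `2^ℓ · poly`")]
[cite: AroraBarakCC2009, §2.6.2 and §1.3] -/
theorem exists_outputsWithin_sim (hL₁ : L₁ ∈ Classes.P) (hF : F ∈ FP) :
    ∃ (M : Turing.TM2ComputableAux Bool Bool) (a j : ℕ), ∀ x : List Bool,
      M.OutputsWithin x (encodeBool ((simLang L₁ q₁ F c₀ J).boolIndicator x))
        (a * (2 ^ sOf c₀ J x.length + x.length + 2) ^ j + a) := by
  obtain ⟨pF, MF, hMF⟩ := preF_mem_FP c₀ J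
  obtain ⟨CE, ME, hME⟩ := exists_timeComputable_expPad (k := 1) le_rfl
  obtain ⟨pQ, MQ, hMQ⟩ := verdictF_mem_FP q₁ c₀ J hL₁ hF
  obtain ⟨cF, kF, hcF⟩ := exists_eval_le_mul_pow_add pF
  obtain ⟨cQ, kQ, hcQ⟩ := exists_eval_le_mul_pow_add pQ
  refine ⟨MF.comp ((mapFstAux ME).comp MQ), cF + cQ * 4 ^ kQ + CE + 10 + (cF + cQ + CE + 6), kF + kQ + 1,
    fun x => ?_⟩
  obtain ⟨n, hn⟩ : ∃ n, n = x.length := ⟨_, rfl⟩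
  obtain ⟨s, hs⟩ : ∃ s, s = sOf c₀ J x.length := ⟨_, rfl⟩
  have hP : padIn c₀ J x = boolPair (expPad 1 (ones s)) x := by rw [padIn, hs]
  -- stage 1
  have h1 : MF.OutputsWithin x (boolPair (ones s) x) (pF.eval n) := by
    have := hMF x
    simp only [id, preF_apply] at this
    rwa [← hs, ← hn] at this
  -- stage 2
  have h2 : (mapFstAux ME).OutputsWithin (boolPair (ones s) x) (padIn c₀ J x)
      ((CE * 2 ^ ((ones s).length ^ 1) + CE) + 3 * (expPad 1 (ones s)).length + 2 * (boolPair (ones s) x).length + 6) := by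
    have h := outputsWithin_mapFstAux ME (z := boolPair (ones s) x) (out := expPad 1 (ones s))
      (m := CE * 2 ^ ((ones s).length ^ 1) + CE) (by simpa using hME (ones s))
    rwa [readRest_boolPair, ← hP] at h
  -- stage 3
  have h3 : MQ.OutputsWithin (padIn c₀ J x) (encodeBool ((simLang L₁ q₁ F c₀ J).boolIndicator x))
      (pQ.eval (padIn c₀ J x).length) := by
    have := hMQ (padIn c₀ J x)
    rwa [id, verdictF_padIn_eq_encodeBool] at this
  have h := Turing.TM2ComputableAux.comp_outputsWithin MF _ h1
    (Turing.TM2ComputableAux.comp_outputsWithin _ MQ h2 h3)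
  have hs' : s = sOf c₀ J n := by rw [hs, hn]
  rw [← hn, ← hs']
  refine h.mono ?_
  -- time bookkeeping in terms of `Z = 2^s + n + 2`
  obtain ⟨Z, hZ⟩ : ∃ Z, Z = 2 ^ s + n + 2 := ⟨_, rfl⟩
  rw [← hZ]
  have h2s : 1 ≤ 2 ^ s := Nat.one_le_two_pow
  have hZ1 : 1 ≤ Z := by omega
  have hsZ : s ≤ 2 ^ s := Nat.lt_two_pow_self.le
  have hlen1 : (ones s).length = s := by simp [ones]
  have hlenE : (expPad 1 (ones s)).length = 2 ^ s + s + 1 := by rw [length_expPad, hlen1, pow_one]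
  have hlen2 : (boolPair (ones s) x).length = 2 * s + 2 + n := by rw [length_boolPair, hlen1, hn]
  have hlenP : (padIn c₀ J x).length ≤ 4 * Z := by
    have : (padIn c₀ J x).length = 2 * (2 ^ s + s + 1) + 2 + n := by
      rw [hP, length_boolPair, hlenE, hn]
    rw [this]; omega
  have hqF : pF.eval n ≤ cF * 1 ^ kF * Z ^ kF + cF := eval_le_of_le_mul hcF (b := 1) (by omega)
  have hqQ : pQ.eval (padIn c₀ J x).length ≤ cQ * 4 ^ kQ * Z ^ kQ + cQ := eval_le_of_le_mul hcQ hlenP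
  have hmid : CE * 2 ^ ((ones s).length ^ 1) + CE + 3 * (expPad 1 (ones s)).length +
      2 * (boolPair (ones s) x).length + 6 ≤ (CE + 10) * Z + (CE + 6) := by
    rw [hlen1, pow_one, hlenE, hlen2]; nlinarith
  -- powers of `Z` against `Z^j`, `j = kF + kQ + 1`
  have hZj : ∀ i, i ≤ kF + kQ + 1 → Z ^ i ≤ Z ^ (kF + kQ + 1) := fun i hi => Nat.pow_le_pow_right hZ1 hi
  have hZF := hZj kF (by omega)
  have hZQ := hZj kQ (by omega)
  have hZ1j : Z ≤ Z ^ (kF + kQ + 1) := by simpa using hZj 1 (by omega)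
  rw [one_pow, mul_one] at hqF
  calc pQ.eval (padIn c₀ J x).length + (CE * 2 ^ ((ones s).length ^ 1) + CE + 3 * (expPad 1 (ones s)).length +
        2 * (boolPair (ones s) x).length + 6) + pF.eval n
      ≤ (cQ * 4 ^ kQ * Z ^ kQ + cQ) + ((CE + 10) * Z + (CE + 6)) + (cF * Z ^ kF + cF) :=
        Nat.add_le_add (Nat.add_le_add hqQ hmid) hqF
    _ ≤ (cQ * 4 ^ kQ * Z ^ (kF + kQ + 1) + cQ) + ((CE + 10) * Z ^ (kF + kQ + 1) + (CE + 6)) +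
          (cF * Z ^ (kF + kQ + 1) + cF) := by
        gcongr
    _ = (cF + cQ * 4 ^ kQ + CE + 10) * Z ^ (kF + kQ + 1) + (cF + cQ + CE + 6) := by ring
    _ ≤ (cF + cQ * 4 ^ kQ + CE + 10 + (cF + cQ + CE + 6)) * Z ^ (kF + kQ + 1) +
          (cF + cQ * 4 ^ kQ + CE + 10 + (cF + cQ + CE + 6)) :=
        Nat.add_le_add (Nat.mul_le_mul_right _ (Nat.le_add_right _ _)) (Nat.le_add_left _ _)

/-- **The simulated language is in `DTIME(2^{⌈n^ε⌉₊})` once `c₀ · 2^{-J} < ε`.** For `L₁ ∈ P`,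
`F ∈ FP` and `c₀ 2^{-J} < ε`: `simLang L₁ q₁ F c₀ J ∈ DTIME (fun n => 2 ^ ⌈(n : ℝ) ^ ε⌉₊)` — the language `B`
of van Melkebeek's Thm. 6.2.1 / the algorithm `A` of Trevisan–Vadhan's Lemma 2.3 at seed length
`ℓ(n)^{c₀} ≤ n^{c₀/2^J}`. [cite: VanMelkebeek2000, Thm. 6.2.1 (`B ∈ DTIME[2^{n^ε}]`)]
[cite: TrevisanVadhan2007, Lemma 2.3] -/
theorem simLang_mem_DTIME (hL₁ : L₁ ∈ Classes.P) (hF : F ∈ FP) {ε : ℝ} (hε : (c₀ : ℝ) * (1 / 2 : ℝ) ^ J < ε) :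
    simLang L₁ q₁ F c₀ J ∈ DTIME (fun n => 2 ^ ⌈(n : ℝ) ^ ε⌉₊) := by
  obtain ⟨M, a, j, hM⟩ := exists_outputsWithin_sim q₁ c₀ J hL₁ hF
  obtain ⟨c', hc'⟩ := exists_time_bound c₀ J a j hε
  exact ⟨c', M, fun x => (hM x).mono (hc' x.length)⟩

end Sim

end UDerand

end Literature.Computability.Complexity

end
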